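import Summits.CriticalPhenomena.CardyFormulaZ2.Theorems.CardyUSTContinuationTargetAccumulation

/-!
# Crux `Target` (stmt-CriticalPhenomena-6046, route `CardyUSTContinuation`) — rigidity of the
# conjunction, UNIFORM form: locally uniform convergence in the fugacity and Cardy's formula along
# any moving fugacity `q_δ → 1`

`Target = SmallFugacityLimit ∧ UniformAnalyticExtension` (X_S ∧ X_A).  The landed accumulation glue
(`CardyUSTContinuationTargetAccumulation`) shows that under X_A the Miller–Werner limit
`u_R(t, δ) → U(t, η)` at fugacities accumulating at ONE point of `(0, 1]` propagates to every
`t ∈ (0, 1]`, pointwise, with all `t`-derivatives.  Here the same Vitali–Porter argument is run in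
its UNIFORM form:
* `tendstoUniformlyOn_thickening_of_frequently_tendsto` — on the `ρ`-thickening `S` of `[t₁, 1] ⊆ ℂ`,
  a family `g δ` holomorphic and bounded by one `M` on `S` (small `δ > 0`) converging to a
  holomorphic `G` at real points accumulating at a real `c`, `↑c ∈ S`, converges to `G` UNIFORMLY
  on every compact `K ⊆ S` along the filter `𝓝[>] 0` (sequences extracted from a failure of
  uniformity by `Filter.exists_seq_forall_of_frequently`, then Vitali along the sequence);
* `tendstoUniformlyOn_of_frequently` — one conformal rectangle: (A) + (C₂) + crossing limits along
  fugacities accumulating at one point of `(0, 1]` give `u(·, δ) → U(·, η)` UNIFORMLY on every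
  `[t₁, 1]`, `t₁ > 0`;
* `hasCrossingLimit_comp_of_frequently` — hence along ANY moving fugacity `τ δ → c ∈ (0, 1]`
  (`τ δ ≤ 1`), `u(τ δ, δ) → U(c, η)`;
* the registered stub UG `…Cruxes.Target.CardyUSTContinuationBirth.stub_uniformGlue` of skeleton v7
  (A → W′ → moving-fugacity form M);
* route statements: `cardyUST_target_tendstoUniformlyOn`, `cardyUST_target_movingFugacity` and
  `cardyUST_target_cardy_movingFugacity` — under `Target`, the jointly-wired self-dual
  FK(`q_δ = τ(δ)²`) crossing probabilities of `Ω_δ` converge to CARDY's formula whenever `q_δ → 1⁻`,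
  at any rate (near-critical-in-`q` window of width zero: a second falsifier of `Target` at the
  percolation end, by FK Monte Carlo at `q = 1 - δ^a`).
Ingredients: `Literature.Analysis.Complex.exists_tendstoLocallyUniformlyOn_of_frequently_tendsto`
(Vitali), `tendstoLocallyUniformlyOn_iff_forall_isCompact`, `TendstoUniformlyOn.tendsto_comp`,
the landed `continuumFamily_proof`, `cardyUST_frequently_of_window`,
`cardyUST_window_of_smallFugacityLimit`.
-/

namespace Summit.CriticalPhenomena.CardyFormulaZ2.Theorems

open Filter Set Metric Topology Complex
open Literature.Probability.RandomPlanarGeometry Literature.Probability.Percolation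
open Summit.CriticalPhenomena.CardyFormulaZ2.Theses.CardyUSTContinuation

/-- **Vitali–Porter on a thickened segment, uniform form.** If `g δ` is, for all small `δ > 0`,
holomorphic on the `ρ`-neighbourhood `S` of `[t₁, 1] ⊆ ℂ` and bounded there by `M`, `G` is
holomorphic on `S`, `↑c ∈ S` for a real `c`, and `g δ s → G s` (`δ → 0⁺`) for real `s ≠ c`
arbitrarily close to `c`, then `g δ → G` UNIFORMLY on every compact `K ⊆ S` as `δ → 0⁺`. -/
theorem tendstoUniformlyOn_thickening_of_frequently_tendsto {t₁ ρ M c : ℝ}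
    (g : ℝ → ℂ → ℂ) (G : ℂ → ℂ)
    (hg : ∀ᶠ δ in 𝓝[>] (0:ℝ),
      DifferentiableOn ℂ (g δ) (thickening ρ (((↑) : ℝ → ℂ) '' Icc t₁ 1)) ∧
        ∀ z ∈ thickening ρ (((↑) : ℝ → ℂ) '' Icc t₁ 1), ‖g δ z‖ ≤ M)
    (hG : DifferentiableOn ℂ G (thickening ρ (((↑) : ℝ → ℂ) '' Icc t₁ 1)))
    (hc : (c : ℂ) ∈ thickening ρ (((↑) : ℝ → ℂ) '' Icc t₁ 1))
    (hconv : ∃ᶠ s : ℝ in 𝓝[≠] c, Tendsto (fun δ => g δ s) (𝓝[>] 0) (𝓝 (G s)))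
    {K : Set ℂ} (hK : IsCompact K) (hKS : K ⊆ thickening ρ (((↑) : ℝ → ℂ) '' Icc t₁ 1)) :
    TendstoUniformlyOn g G (𝓝[>] 0) K := by
  set S : Set ℂ := thickening ρ (((↑) : ℝ → ℂ) '' Icc t₁ 1) with hS
  have hSo : IsOpen S := isOpen_thickening
  have hSc : IsPreconnected S := ((convex_ofReal_image_Icc t₁ 1).thickening ρ).isPreconnected
  have hnearS : ∀ᶠ s : ℝ in 𝓝[≠] c, (s : ℂ) ∈ S :=
    mem_nhdsWithin_of_mem_nhds (continuous_ofReal.continuousAt.preimage_mem_nhds (hSo.mem_nhds hc))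
  have htend : Tendsto (fun s : ℝ => (s : ℂ)) (𝓝[≠] c) (𝓝[≠] (c : ℂ)) := by
    refine tendsto_nhdsWithin_iff.2
      ⟨continuous_ofReal.continuousAt.tendsto.mono_left nhdsWithin_le_nhds, ?_⟩
    filter_upwards [self_mem_nhdsWithin] with s hs
    simpa using hs
  rw [Metric.tendstoUniformlyOn_iff]
  intro ε hε
  by_contra hnot
  -- a sequence `δ n → 0⁺` along which uniformity fails at level `ε`
  obtain ⟨δ, hδ, hbad⟩ := exists_seq_forall_of_frequently (not_eventually.1 hnot)
  classical
  -- the good indices: `g (δ n)` holomorphic on `S` and bounded by `M`; the repaired sequence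
  set P : ℝ → Prop := fun d => DifferentiableOn ℂ (g d) S ∧ ∀ z ∈ S, ‖g d z‖ ≤ M with hP
  have hPev : ∀ᶠ n in atTop, P (δ n) := hδ.eventually hg
  set F : ℕ → ℂ → ℂ := fun n => if P (δ n) then g (δ n) else fun _ => 0 with hF
  have hFeq : ∀ᶠ n in atTop, F n = g (δ n) := by
    filter_upwards [hPev] with n hn
    simp only [hF, if_pos hn]
  have hFd : ∀ n, DifferentiableOn ℂ (F n) S := by
    intro n
    by_cases hn : P (δ n)
    · simp only [hF, if_pos hn]; exact hn.1
    · simp only [hF, if_neg hn]; exact differentiableOn_const 0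
  have hFb : ∀ n, ∀ z ∈ S, ‖F n z‖ ≤ max M 0 := by
    intro n z hz
    by_cases hn : P (δ n)
    · simp only [hF, if_pos hn]; exact (hn.2 z hz).trans (le_max_left _ _)
    · simp only [hF, if_neg hn, norm_zero]; exact le_max_right _ _
  have hbd : ∀ a ∈ S, ∃ M' : ℝ, ∃ r > 0, ∀ n, ∀ z ∈ ball a r ∩ S, ‖F n z‖ ≤ M' :=
    fun a _ => ⟨max M 0, 1, one_pos, fun n z hz => hFb n z hz.2⟩
  have hpt : ∀ s : ℝ, Tendsto (fun d => g d s) (𝓝[>] 0) (𝓝 (G s)) →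
      Tendsto (fun n => F n s) atTop (𝓝 (G s)) := by
    intro s hs
    refine (hs.comp hδ).congr' ?_
    filter_upwards [hFeq] with n hn
    simp [hn]
  have hfreq : ∃ᶠ z in 𝓝[≠] (c : ℂ), ∃ e : ℂ, Tendsto (fun n => F n z) atTop (𝓝 e) :=
    htend.frequently (hconv.mono fun s hs => ⟨G s, hpt s hs⟩)
  -- Vitali's convergence theorem along the sequence
  obtain ⟨f, hf, hlim⟩ :=
    Literature.Analysis.Complex.exists_tendstoLocallyUniformlyOn_of_frequently_tendsto hSo hSc
      hFd hbd hc hfreq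
  -- the limit is `G` (identity theorem)
  have hfG : EqOn f G S := by
    have hfr : ∃ᶠ z in 𝓝[≠] (c : ℂ), f z = G z := by
      refine htend.frequently ((hconv.and_eventually hnearS).mono ?_)
      rintro s ⟨hs, hsS⟩
      exact tendsto_nhds_unique (hlim.tendsto_at hsS) (hpt s hs)
    exact (hf.analyticOnNhd hSo).eqOn_of_preconnected_of_frequently_eq (hG.analyticOnNhd hSo) hSc
      hc hfr
  -- uniform convergence on the compact `K`, contradiction
  have hKu : TendstoUniformlyOn F f atTop K :=
    (tendstoLocallyUniformlyOn_iff_forall_isCompact hSo).1 hlim K hKS hK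
  have h2 : ∀ᶠ n in atTop, ∀ x ∈ K, dist (G x) (g (δ n) x) < ε := by
    filter_upwards [(Metric.tendstoUniformlyOn_iff.1 hKu) ε hε, hFeq] with n hn hFn x hx
    have h := hn x hx
    rwa [hfG (hKS hx), hFn] at h
  obtain ⟨n, hn⟩ := h2.exists
  exact hbad n hn

/-- **Accumulation rigidity, one conformal rectangle, uniform in the fugacity.** Under (A)
δ-uniform bounded analytic extensions of `t ↦ u t δ` near every `[t₁, 1]`, (C₂) analytic
continuation of each `U · η` near `[0, 1]`, and (W′) crossing limits `u s · → U s` along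
fugacities `s ∈ (0, 1]` accumulating at some `c ∈ (0, 1]`: for every uniformizing datum `(φ, x)`
and every `t₁ ∈ (0, 1)`, `u(·, δ) → U(·, crossRatio x)` UNIFORMLY on `[t₁, 1]` as `δ → 0⁺`. -/
theorem tendstoUniformlyOn_of_frequently (U : ℝ → ℝ → ℝ) (u : ℝ → ℝ → ℝ) (R : ConformalRectangle)
    (hA : ∀ t₁ ∈ Set.Ioo (0:ℝ) 1, ∃ ρ > (0:ℝ), ∃ M : ℝ,
      ∀ᶠ δ in 𝓝[>] (0:ℝ), ∃ g : ℂ → ℂ,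
        DifferentiableOn ℂ g (Metric.thickening ρ (((↑) : ℝ → ℂ) '' Set.Icc t₁ 1)) ∧
        (∀ z ∈ Metric.thickening ρ (((↑) : ℝ → ℂ) '' Set.Icc t₁ 1), ‖g z‖ ≤ M) ∧
        ∀ t ∈ Set.Icc t₁ 1, g t = u t δ)
    (hC₂ : ∀ η ∈ Set.Ioo (0:ℝ) 1, ∃ ρ > (0:ℝ), ∃ Uc : ℂ → ℂ,
      DifferentiableOn ℂ Uc (Metric.thickening ρ (((↑) : ℝ → ℂ) '' Set.Icc (0:ℝ) 1)) ∧
        ∀ t ∈ Set.Icc (0:ℝ) 1, Uc t = U t η)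
    (hW : ∃ c ∈ Set.Ioc (0:ℝ) 1, ∃ᶠ s in 𝓝[≠] c,
      s ∈ Set.Ioc (0:ℝ) 1 ∧ R.HasCrossingLimit (fun δ => u s δ) (U s))
    {t₁ : ℝ} (ht₁ : t₁ ∈ Set.Ioo (0:ℝ) 1)
    {φ : ConformalEquiv UpperHalfPlane.upperHalfPlaneSet R.carrier}
    {x : Fin 4 → ℝ} (hφx : R.IsUniformizing φ x) :
    TendstoUniformlyOn (fun δ t => u t δ) (fun t => U t (crossRatio x)) (𝓝[>] 0)
      (Set.Icc t₁ 1) := by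
  have hη01 : crossRatio x ∈ Set.Ioo (0:ℝ) 1 :=
    ConformalRectangle.crossRatio_mem_Ioo_of_isUniformizing hφx
  obtain ⟨c, hc, hfr⟩ := hW
  -- the segment `[t₁', 1]`, `t₁' := min t₁ c / 2`, containing `[t₁, 1]` and a neighbourhood of `c`
  set t₁' : ℝ := min t₁ c / 2 with ht₁'def
  have hmin : 0 < min t₁ c := lt_min ht₁.1 hc.1
  have ht₁'0 : 0 < t₁' := by rw [ht₁'def]; positivity
  have ht₁'t : t₁' < t₁ := by
    rw [ht₁'def]; linarith [min_le_left t₁ c, ht₁.1]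
  have ht₁'c : t₁' < c := by
    rw [ht₁'def]; linarith [min_le_right t₁ c, hc.1]
  have ht₁'1 : t₁' < 1 := ht₁'t.trans ht₁.2
  obtain ⟨ρ, hρ, M, hAev⟩ := hA t₁' ⟨ht₁'0, ht₁'1⟩
  obtain ⟨ρ', hρ', Uc, hUc, hUcU⟩ := hC₂ _ hη01
  set K₀ : Set ℂ := ((↑) : ℝ → ℂ) '' Set.Icc t₁' 1 with hK₀
  set ρ₀ : ℝ := min ρ ρ' with hρ₀
  have hρ₀0 : 0 < ρ₀ := lt_min hρ hρ'
  have hsub₁ : Metric.thickening ρ₀ K₀ ⊆ Metric.thickening ρ K₀ :=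
    Metric.thickening_mono (min_le_left _ _) _
  have hsub₂ : Metric.thickening ρ₀ K₀ ⊆
      Metric.thickening ρ' (((↑) : ℝ → ℂ) '' Set.Icc (0:ℝ) 1) :=
    (Metric.thickening_mono (min_le_right _ _) _).trans
      (Metric.thickening_subset_of_subset _ (Set.image_mono (Set.Icc_subset_Icc_left ht₁'0.le)))
  -- choose the analytic extensions `g δ` (arbitrary where none exists)
  obtain ⟨g, hgP⟩ : ∃ g : ℝ → ℂ → ℂ, ∀ᶠ δ in 𝓝[>] (0:ℝ),
      DifferentiableOn ℂ (g δ) (Metric.thickening ρ K₀) ∧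
      (∀ z ∈ Metric.thickening ρ K₀, ‖g δ z‖ ≤ M) ∧
      ∀ s ∈ Set.Icc t₁' 1, g δ s = u s δ :=
    ⟨fun δ => Classical.epsilon (fun g : ℂ → ℂ =>
        DifferentiableOn ℂ g (Metric.thickening ρ K₀) ∧
        (∀ z ∈ Metric.thickening ρ K₀, ‖g z‖ ≤ M) ∧
        ∀ s ∈ Set.Icc t₁' 1, g s = u s δ),
      hAev.mono fun δ hδ => Classical.epsilon_spec hδ⟩
  have hcK : (c : ℂ) ∈ Metric.thickening ρ₀ K₀ :=
    Metric.self_subset_thickening hρ₀0 K₀ ⟨c, ⟨ht₁'c.le, hc.2⟩, rfl⟩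
  -- convergence at the good fugacities near `c`
  have hconv : ∃ᶠ s : ℝ in 𝓝[≠] c, Tendsto (fun δ => g δ s) (𝓝[>] 0) (𝓝 (Uc s)) := by
    have hnear : ∀ᶠ s : ℝ in 𝓝[≠] c, t₁' < s := mem_nhdsWithin_of_mem_nhds (Ioi_mem_nhds ht₁'c)
    refine (hfr.and_eventually hnear).mono ?_
    rintro s ⟨⟨hs01, hHs⟩, hs⟩
    have hsIcc : s ∈ Set.Icc t₁' 1 := ⟨hs.le, hs01.2⟩
    have hlimC : Tendsto (fun δ => ((u s δ : ℝ) : ℂ)) (𝓝[>] 0)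
        (𝓝 ((U s (crossRatio x) : ℝ) : ℂ)) :=
      (Complex.continuous_ofReal.tendsto _).comp (hHs φ x hφx)
    rw [hUcU s ⟨hs01.1.le, hs01.2⟩]
    refine hlimC.congr' ?_
    filter_upwards [hgP] with δ hδ
    exact (hδ.2.2 s hsIcc).symm
  -- the compact complex segment `[t₁, 1]` inside the shrunk neighbourhood
  set K : Set ℂ := ((↑) : ℝ → ℂ) '' Set.Icc t₁ 1 with hK
  have hKc : IsCompact K := isCompact_Icc.image Complex.continuous_ofReal
  have hKS : K ⊆ Metric.thickening ρ₀ K₀ :=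
    (Set.image_mono (Set.Icc_subset_Icc_left ht₁'t.le)).trans (Metric.self_subset_thickening hρ₀0 K₀)
  -- Vitali–Porter, uniform form, on `K`
  have hV := tendstoUniformlyOn_thickening_of_frequently_tendsto (M := M) g Uc
    (hgP.mono fun δ hδ => ⟨hδ.1.mono hsub₁, fun z hz => hδ.2.1 z (hsub₁ hz)⟩)
    (hUc.mono hsub₂) hcK hconv hKc hKS
  -- back to the reals
  rw [Metric.tendstoUniformlyOn_iff] at hV ⊢
  intro ε hε
  filter_upwards [hV ε hε, hgP] with δ hδ hgδ t ht
  have htK : (t : ℂ) ∈ K := ⟨t, ht, rfl⟩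
  have h1 := hδ (t : ℂ) htK
  rw [hUcU t ⟨ht₁.1.le.trans ht.1, ht.2⟩, hgδ.2.2 t ⟨ht₁'t.le.trans ht.1, ht.2⟩,
    Complex.isometry_ofReal.dist_eq] at h1
  exact h1

/-- **Moving fugacity, one conformal rectangle.** Under (A), (C₂), (W′) as in
`tendstoUniformlyOn_of_frequently`: along ANY fugacity `τ δ → c ∈ (0, 1]` with `τ δ ≤ 1`
eventually, the crossing probabilities `u (τ δ) δ` have crossing limit `U c`. -/
theorem hasCrossingLimit_comp_of_frequently (U : ℝ → ℝ → ℝ) (u : ℝ → ℝ → ℝ)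
    (R : ConformalRectangle)
    (hA : ∀ t₁ ∈ Set.Ioo (0:ℝ) 1, ∃ ρ > (0:ℝ), ∃ M : ℝ,
      ∀ᶠ δ in 𝓝[>] (0:ℝ), ∃ g : ℂ → ℂ,
        DifferentiableOn ℂ g (Metric.thickening ρ (((↑) : ℝ → ℂ) '' Set.Icc t₁ 1)) ∧
        (∀ z ∈ Metric.thickening ρ (((↑) : ℝ → ℂ) '' Set.Icc t₁ 1), ‖g z‖ ≤ M) ∧
        ∀ t ∈ Set.Icc t₁ 1, g t = u t δ)
    (hC₂ : ∀ η ∈ Set.Ioo (0:ℝ) 1, ∃ ρ > (0:ℝ), ∃ Uc : ℂ → ℂ,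
      DifferentiableOn ℂ Uc (Metric.thickening ρ (((↑) : ℝ → ℂ) '' Set.Icc (0:ℝ) 1)) ∧
        ∀ t ∈ Set.Icc (0:ℝ) 1, Uc t = U t η)
    (hW : ∃ c ∈ Set.Ioc (0:ℝ) 1, ∃ᶠ s in 𝓝[≠] c,
      s ∈ Set.Ioc (0:ℝ) 1 ∧ R.HasCrossingLimit (fun δ => u s δ) (U s))
    {c : ℝ} (hc : c ∈ Set.Ioc (0:ℝ) 1) {τ : ℝ → ℝ} (hτ : Tendsto τ (𝓝[>] 0) (𝓝 c))
    (hτ1 : ∀ᶠ δ in 𝓝[>] (0:ℝ), τ δ ≤ 1) :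
    R.HasCrossingLimit (fun δ => u (τ δ) δ) (U c) := by
  intro φ x hφx
  have hη01 : crossRatio x ∈ Set.Ioo (0:ℝ) 1 :=
    ConformalRectangle.crossRatio_mem_Ioo_of_isUniformizing hφx
  have ht₁ : c / 2 ∈ Set.Ioo (0:ℝ) 1 := ⟨by linarith [hc.1], by linarith [hc.2]⟩
  have hunif := tendstoUniformlyOn_of_frequently U u R hA hC₂ hW ht₁ hφx
  -- continuity of `t ↦ U t η` at `c` within `[c/2, 1]` (restriction of the analytic `Uc`)
  obtain ⟨ρ', hρ', Uc, hUc, hUcU⟩ := hC₂ _ hη01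
  have hcS : (c : ℂ) ∈ Metric.thickening ρ' (((↑) : ℝ → ℂ) '' Set.Icc (0:ℝ) 1) :=
    Metric.self_subset_thickening hρ' _ ⟨c, ⟨hc.1.le, hc.2⟩, rfl⟩
  have hUca : ContinuousAt Uc (c : ℂ) :=
    (hUc.differentiableAt (Metric.isOpen_thickening.mem_nhds hcS)).continuousAt
  have hre : ContinuousAt (fun t : ℝ => (Uc t).re) c :=
    Complex.continuous_re.continuousAt.comp (hUca.comp Complex.continuous_ofReal.continuousAt)
  have hcont : ContinuousWithinAt (fun t => U t (crossRatio x)) (Set.Icc (c / 2) 1) c := by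
    refine hre.continuousWithinAt.congr (fun y hy => ?_) ?_
    · have h := congrArg Complex.re (hUcU y ⟨by linarith [hy.1, hc.1], hy.2⟩)
      simpa using h.symm
    · have h := congrArg Complex.re (hUcU c ⟨hc.1.le, hc.2⟩)
      simpa using h.symm
  -- `τ δ → c` within `[c/2, 1]`
  have hτ' : Tendsto τ (𝓝[>] 0) (𝓝[Set.Icc (c / 2) 1] c) := by
    refine tendsto_nhdsWithin_iff.2 ⟨hτ, ?_⟩
    have hlow : ∀ᶠ δ in 𝓝[>] (0:ℝ), c / 2 < τ δ := hτ (Ioi_mem_nhds (by linarith [hc.1]))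
    filter_upwards [hlow, hτ1] with δ h1 h2
    exact ⟨h1.le, h2⟩
  exact hunif.tendsto_comp hcont hτ'


/-! ### The route statements under `Target` -/

/-- **`Target` gives locally uniform convergence in the fugacity.** Under the crux, for every
conformal rectangle `R`, every uniformizing datum `(φ, x)` and every `t₁ ∈ (0, 1)`, the
jointly-wired self-dual FK crossing probabilities converge to the Miller–Werner law UNIFORMLY in
`t ∈ [t₁, 1]`: `sup_{t ∈ [t₁,1]} |u_R(t, δ) - U(t, crossRatio x)| → 0` as `δ → 0⁺`. -/
theorem cardyUST_target_tendstoUniformlyOn (hT : Target) :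
    let Z : ℝ → ℝ → ℝ := fun u x => x ^ (u / 2) * (1 - x) ^ (1 - 3 * u / 2) * ₂F₁ u (1 - u) (2 * u) x; let U : ℝ → ℝ → ℝ := fun t η => t * Z (Real.arccos (-(t / 2)) / Real.pi) η / (Z (Real.arccos (-(t / 2)) / Real.pi) (1 - η) + t * Z (Real.arccos (-(t / 2)) / Real.pi) η); let uJ : Literature.Probability.RandomPlanarGeometry.ConformalRectangle → ℝ → ℝ → ℝ := fun R t δ => if h : 0 < δ then (@Literature.Probability.LatticeModels.fkDomainMeasure R.carrier δ (t / (1 + t)) (t ^ 2) (R.arc 0 ∪ R.arc 2) (Literature.Probability.LatticeModels.meshDomain_finite R.isBounded h).fintype).real (Literature.Probability.Percolation.discreteCrossing R.carrier δ (R.arc 0) (R.arc 2)) else 0; ∀ R : Literature.Probability.RandomPlanarGeometry.ConformalRectangle, ∀ (φ : ConformalEquiv UpperHalfPlane.upperHalfPlaneSet R.carrier) (x : Fin 4 → ℝ), R.IsUniformizing φ x → ∀ t₁ ∈ Set.Ioo (0:ℝ) 1, TendstoUniformlyOn (fun δ t => uJ R t δ) (fun t => U t (crossRatio x)) (𝓝[>]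 0) (Set.Icc t₁ 1) := by
  have hC := continuumFamily_proof
  unfold ContinuumFamily at hC
  have hS : SmallFugacityLimit := hT.1
  have hA : UniformAnalyticExtension := hT.2
  have hW := cardyUST_frequently_of_window (cardyUST_window_of_smallFugacityLimit hS)
  unfold UniformAnalyticExtension at hA
  intro Z U uJ R φ x hφx t₁ ht₁
  exact tendstoUniformlyOn_of_frequently _ _ R (hA R) hC.2 (hW R) ht₁ hφx

/-- **`Target` along a moving fugacity.** Under the crux, for every conformal rectangle `R`, every
`c ∈ (0, 1]` and every fugacity schedule `τ` with `τ δ → c` as `δ → 0⁺` and `τ δ ≤ 1` eventually,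
the jointly-wired self-dual FK(`q = τ(δ)²`) crossing probabilities `u_R(τ δ, δ)` have crossing
limit the Miller–Werner law `U c`. -/
theorem cardyUST_target_movingFugacity (hT : Target) :
    let Z : ℝ → ℝ → ℝ := fun u x => x ^ (u / 2) * (1 - x) ^ (1 - 3 * u / 2) * ₂F₁ u (1 - u) (2 * u) x; let U : ℝ → ℝ → ℝ := fun t η => t * Z (Real.arccos (-(t / 2)) / Real.pi) η / (Z (Real.arccos (-(t / 2)) / Real.pi) (1 - η) + t * Z (Real.arccos (-(t / 2)) / Real.pi) η); let uJ : Literature.Probability.RandomPlanarGeometry.ConformalRectangle → ℝ → ℝ → ℝ := fun R t δ => if h : 0 < δ then (@Literature.Probability.LatticeModels.fkDomainMeasure R.carrier δ (t / (1 + t)) (t ^ 2) (R.arc 0 ∪ R.arc 2) (Literature.Probability.LatticeModels.meshDomain_finite R.isBounded h).fintype).real (Literature.Probability.Percolation.discreteCrossing R.carrier δ (R.arc 0) (R.arc 2)) else 0; ∀ R : Literature.Probability.RandomPlanarGeometry.ConformalRectangle, ∀ c ∈ Set.Ioc (0:ℝ) 1, ∀ τ : ℝ → ℝ, Tendsto τ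 (𝓝[>] 0) (𝓝 c) → (∀ᶠ δ in 𝓝[>] (0:ℝ), τ δ ≤ 1) → R.HasCrossingLimit (fun δ => uJ R (τ δ) δ) (U c) := by
  have hC := continuumFamily_proof
  unfold ContinuumFamily at hC
  have hS : SmallFugacityLimit := hT.1
  have hA : UniformAnalyticExtension := hT.2
  have hW := cardyUST_frequently_of_window (cardyUST_window_of_smallFugacityLimit hS)
  unfold UniformAnalyticExtension at hA
  intro Z U uJ R c hc τ hτ hτ1
  exact hasCrossingLimit_comp_of_frequently _ _ R (hA R) hC.2 (hW R) hc hτ hτ1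

/-- **Cardy's formula along any fugacity `q_δ → 1⁻` (near-critical-in-`q` window of width zero).**
Under the crux `Target`, for every conformal rectangle `R` and every schedule `τ δ → 1`,
`τ δ ≤ 1`, the jointly-wired self-dual FK(`q_δ = τ(δ)²`) crossing probabilities of G02's
discretisation `Ω_δ` converge to CARDY's formula: `R.HasCrossingLimit (u_R(τ ·, ·)) cardyFunction`
— bond percolation (`τ ≡ 1`, the sub-problem `CardyFormulaZ2` via `bernoulliEndpoint_proof`) is
the constant schedule; `q_δ = 1 - δ^a` for any `a > 0` is a falsifier of `Target` by FK Monte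
Carlo at the percolation end. -/
theorem cardyUST_target_cardy_movingFugacity (hT : Target) :
    let uJ : Literature.Probability.RandomPlanarGeometry.ConformalRectangle → ℝ → ℝ → ℝ := fun R t δ => if h : 0 < δ then (@Literature.Probability.LatticeModels.fkDomainMeasure R.carrier δ (t / (1 + t)) (t ^ 2) (R.arc 0 ∪ R.arc 2) (Literature.Probability.LatticeModels.meshDomain_finite R.isBounded h).fintype).real (Literature.Probability.Percolation.discreteCrossing R.carrier δ (R.arc 0) (R.arc 2)) else 0; ∀ R : Literature.Probability.RandomPlanarGeometry.ConformalRectangle, ∀ τ : ℝ → ℝ, Tendsto τ (𝓝[>] 0) (𝓝 1) → (∀ᶠ δ in 𝓝[>] (0:ℝ), τ δ ≤ 1) → R.HasCrossingLimit (fun δ => uJ R (τ δ) δ) Literature.Probability.RandomPlanarGeometry.cardyFunction := by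
  have hC := continuumFamily_proof
  unfold ContinuumFamily at hC
  have hM := cardyUST_target_movingFugacity hT
  intro uJ R τ hτ hτ1 φ x hφx
  have hη01 : crossRatio x ∈ Set.Ioo (0:ℝ) 1 :=
    ConformalRectangle.crossRatio_mem_Ioo_of_isUniformizing hφx
  have h := hM R 1 ⟨one_pos, le_rfl⟩ τ hτ hτ1 φ x hφx
  rw [hC.1 _ hη01] at h
  exact h

end Summit.CriticalPhenomena.CardyFormulaZ2.Theorems

/-! ### The registered stub UG of skeleton v7 (crux `Target`, stmt-CriticalPhenomena-6046) -/

namespace Summit.CriticalPhenomena.CardyFormulaZ2.Cruxes.Target.CardyUSTContinuationBirth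

open scoped Topology
open Filter
open Summit.CriticalPhenomena.CardyFormulaZ2.Theorems
open Summit.CriticalPhenomena.CardyFormulaZ2.Theses.CardyUSTContinuation

/-- **stub_uniformGlue** (registered stub UG of skeleton v7 for the crux `Target`): the Lee–Yang
crux `UniformAnalyticExtension` and the ACCUMULATION form of the small-fugacity crux give the
MOVING-FUGACITY form — for every conformal rectangle, every `c ∈ (0, 1]` and every schedule
`τ δ → c` with `τ δ ≤ 1` eventually, the jointly-wired self-dual FK crossing probabilities
`u_R(τ δ, δ)` have crossing limit the Miller–Werner law `U c` (the route's `let`s `Z, U, uJ` are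
characterised by equations rather than bound).  Constant schedules give back `SmallFugacityLimit`. -/
theorem stub_uniformGlue :
    Summit.CriticalPhenomena.CardyFormulaZ2.Theses.CardyUSTContinuation.UniformAnalyticExtension → (∀ (Z U : ℝ → ℝ → ℝ) (uJ : Literature.Probability.RandomPlanarGeometry.ConformalRectangle → ℝ → ℝ → ℝ), (∀ u x, Z u x = x ^ (u / 2) * (1 - x) ^ (1 - 3 * u / 2) * ₂F₁ u (1 - u) (2 * u) x) → (∀ t η, U t η = t * Z (Real.arccos (-(t / 2)) / Real.pi) η / (Z (Real.arccos (-(t / 2)) / Real.pi) (1 - η) + t * Z (Real.arccos (-(t / 2)) / Real.pi) η)) → (∀ (R : Literature.Probability.RandomPlanarGeometry.ConformalRectangle) (t δ : ℝ), uJ R t δ = if h : 0 < δ then (@Literature.Probability.LatticeModels.fkDomainMeasure R.carrier δ (t / (1 + t)) (t ^ 2) (R.arc 0 ∪ R.arc 2) (Literature.Probability.LatticeModels.meshDomain_finite R.isBounded h).fintype).real (Literature.Probability.Percolation.discreteCrossing R.carrier δ (R.arc 0) (R.arc 2)) else 0) → ∀ R : Literature.Probability.RandomPlanarGeometry.ConformalRectangle,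 ∃ c ∈ Set.Ioc (0:ℝ) 1, ∃ᶠ t in 𝓝[≠] c, t ∈ Set.Ioc (0:ℝ) 1 ∧ R.HasCrossingLimit (fun δ => uJ R t δ) (U t)) → (∀ (Z U : ℝ → ℝ → ℝ) (uJ : Literature.Probability.RandomPlanarGeometry.ConformalRectangle → ℝ → ℝ → ℝ), (∀ u x, Z u x = x ^ (u / 2) * (1 - x) ^ (1 - 3 * u / 2) * ₂F₁ u (1 - u) (2 * u) x) → (∀ t η, U t η = t * Z (Real.arccos (-(t / 2)) / Real.pi) η / (Z (Real.arccos (-(t / 2)) / Real.pi) (1 - η) + t * Z (Real.arccos (-(t / 2)) / Real.pi) η)) → (∀ (R : Literature.Probability.RandomPlanarGeometry.ConformalRectangle) (t δ : ℝ), uJ R t δ = if h : 0 < δ then (@Literature.Probability.LatticeModels.fkDomainMeasure R.carrier δ (t / (1 + t)) (t ^ 2) (R.arc 0 ∪ R.arc 2) (Literature.Probability.LatticeModels.meshDomain_finite R.isBounded h).fintype).real (Literature.Probability.Percolation.discreteCrossing R.carrier δ (R.arc 0) (R.arc 2)) else 0) → ∀ R : Literature.Probability.RandomPlanarGeometry.ConformalRectangle,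 ∀ c ∈ Set.Ioc (0:ℝ) 1, ∀ τ : ℝ → ℝ, Tendsto τ (𝓝[>] 0) (𝓝 c) → (∀ᶠ δ in 𝓝[>] (0:ℝ), τ δ ≤ 1) → R.HasCrossingLimit (fun δ => uJ R (τ δ) δ) (U c)) := by
  intro hA hW Z U uJ hZ hU huJ R c hc τ hτ hτ1
  have hC := continuumFamily_proof
  unfold ContinuumFamily at hC
  unfold UniformAnalyticExtension at hA
  have hWR := hW Z U uJ hZ hU huJ R
  obtain rfl : U = fun t η => t * Z (Real.arccos (-(t / 2)) / Real.pi) η /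
      (Z (Real.arccos (-(t / 2)) / Real.pi) (1 - η) + t * Z (Real.arccos (-(t / 2)) / Real.pi) η) :=
    funext fun t => funext fun η => hU t η
  obtain rfl : Z = fun u x => x ^ (u / 2) * (1 - x) ^ (1 - 3 * u / 2) * ₂F₁ u (1 - u) (2 * u) x :=
    funext fun u => funext fun x => hZ u x
  obtain rfl : uJ = fun R t δ => if h : 0 < δ then
      (@Literature.Probability.LatticeModels.fkDomainMeasure R.carrier δ (t / (1 + t)) (t ^ 2)
        (R.arc 0 ∪ R.arc 2)
        (Literature.Probability.LatticeModels.meshDomain_finite R.isBounded h).fintype).real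
        (Literature.Probability.Percolation.discreteCrossing R.carrier δ (R.arc 0) (R.arc 2)) else 0 :=
    funext fun R => funext fun t => funext fun δ => huJ R t δ
  exact hasCrossingLimit_comp_of_frequently _ _ R (hA R) hC.2 hWR hc hτ hτ1

end Summit.CriticalPhenomena.CardyFormulaZ2.Cruxes.Target.CardyUSTContinuationBirth
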